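import Literature.NumberTheory.LFunctions.DworkRationalityFredholmEntire
import Literature.NumberTheory.LFunctions.DworkRationalityLiftingProofs
import Literature.NumberTheory.LFunctions.DworkRationalityPointCountProofs
import HarnessLib

/-!
# Dwork's rationality theorem: discharge of `exists_polynomial_mul_zetaSeries_eq`

`Literature/NumberTheory/LFunctions/WeilConjectures.lean` vendors **Dwork's theorem** as the named
fact `Literature.NumberTheory.LFunctions.exists_polynomial_mul_zetaSeries_eq`: for every scheme `X`
of finite type over a finite field `k`, the zeta function `Z(X, T) ∈ ℚ⟦T⟧` is rational
(B. Dwork, *On the rationality of the zeta function of an algebraic variety*, Amer. J. Math. 82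
(1960), 631–648, Thm. 1). This file closes it:
`Literature.NumberTheory.LFunctions.exists_polynomial_mul_zetaSeries_eq_holds`.

The proof is the bottom-up formalisation of Dwork's `p`-adic argument in the textbook form of
Koblitz, *p-adic Numbers, p-adic Analysis, and Zeta-Functions*, GTM 58, Ch. V (after Serre,
Sém. Bourbaki 198), spread over the `DworkRationality*.lean` files of this directory:

* reduction to the torus counts `N'_s` of affine hypersurfaces and `Z' ∈ ℤ⟦T⟧` with
  `0 ≤ a_j ≤ q^{nj}` (`DworkRationality`, `…TorusZeta`, `…IntegralityProofs`; Koblitz V.1, V.4);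
* the point counts of a finite-type `k`-scheme as combinations of affine system counts
  (`…PointCountProofs`, `pointCount_eq_sum_systemCount_holds`; Koblitz V.1 Ex. 4–5, Serre §1.6);
* the Borel–Dwork rationality criterion (`…KroneckerProofs`, `…BorelDwork`; Koblitz V.5);
* `p`-adic meromorphy of `Z'`: Dwork's trace formula and the Fredholm determinant of `Ψ = T_q ∘ G`
  on `R₀` (`…Meromorphy`, `…MeromorphyProofs`, `…MeromorphyAssembly`, `…OverconvergentProofs`,
  `…TraceFormulaProofs`, `…Fredholm*`, `dworkFredholm_holds`; Koblitz V.3–V.4);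
* Dwork's splitting function and the lifting of the additive character (`…Splitting`,
  `…DworkLemma`, `…SplittingSeries`, `…SplittingValues`, `…Teichmuller`, `…LiftingProofs`,
  `dworkLifting_holds`; Koblitz IV.2, V.2, V.4 pp. 132–133; Lang, *Cyclotomic Fields I and II*,
  Ch. 14 §2–§3).

## References

* B. Dwork, *On the rationality of the zeta function of an algebraic variety*, Amer. J. Math. 82
  (1960), 631–648, Thm. 1. [Dwork1960]
* N. Koblitz, *p-adic Numbers, p-adic Analysis, and Zeta-Functions*, 2nd ed., GTM 58 (1984),
  Ch. V, "Theorem (Dwork)", p. 122, and §§1–5. [Koblitz1984]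
-/

noncomputable section

universe u

namespace Literature.NumberTheory.LFunctions

/-- **Dwork's rationality theorem** (Dwork, Amer. J. Math. 82 (1960), Thm. 1; Koblitz, GTM 58,
Ch. V, Theorem (Dwork) p. 122 with Ex. 4–5 for varieties and the scheme-theoretic reduction of
`Dwork.pointCount_eq_sum_systemCount_holds`): for every scheme `X` locally of finite type and
quasi-compact over a finite field `k`, there are `p, q ∈ ℚ[T]`, `q ≠ 0`, with `Z(X, T) · q = p` in
`ℚ⟦T⟧` — the discharge of the named fact
`Literature.NumberTheory.LFunctions.exists_polynomial_mul_zetaSeries_eq`, from the two proved inputs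
`Dwork.dworkLifting_holds` (Koblitz V.2/V.4, Lang Ch. 14) and
`Dwork.pointCount_eq_sum_systemCount_holds` through the assembly
`Dwork.exists_polynomial_mul_zetaSeries_eq_of_lifting` (torus zeta `p`-adic meromorphic by the
trace formula and the Fredholm determinant, hence rational by the Borel–Dwork criterion). [cite: Dwork1960, Thm. 1] [cite: Koblitz1984, Ch. V §1 Theorem (Dwork)] -/
theorem exists_polynomial_mul_zetaSeries_eq_holds {k : Type u} [Field k] [Finite k] :
    exists_polynomial_mul_zetaSeries_eq (k := k) :=
  Dwork.exists_polynomial_mul_zetaSeries_eq_of_lifting Dwork.dworkLifting_holds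
    Dwork.pointCount_eq_sum_systemCount_holds

end Literature.NumberTheory.LFunctions
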